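import Literature.NumberTheory.Automorphic.ArchEndoscopicChartOrbLocal          -- ★ p850124 (LH3-p03 (g3)) D2: `chartOrbHLoc`, `chartOrbHLoc_eq_of_isHaarMeasure`; brings D1 `endoBlockAt`, `chartTorusHLoc`, `mem_chartTorusHLoc_iff`
import Literature.NumberTheory.Automorphic.ArchRankOneSplitOrbitContinuity      -- ★ p850189 (F0P3a-p05 (g19)): the `torusU` frame of (A0-b); brings `torusU`, `LineRing.mem_torusU_two_iff`, `LineRing.forall_mem_torusU_comm`
import HarnessLib

/-!
# (DOCK-w₀) At a SPLIT place the local chart torus `T_{S,w}` IS the diagonal torus `torusU`, and `chartOrbHLoc` reads in that frame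
# (Rogawski 1990 §3.6, §8.2; Folland 1995 §2.6)

Topic `NumberTheory/Automorphic`; namespace `Literature.NumberTheory.Automorphic.UnitaryGroup`.  THEOREMS ONLY.  Cell `pub/hodgecm-mathlib`, line LH3
(closer stub `stub_N9`, crux H413 = `stmt-HodgeConjecture-24833`); the shared dock asked for by LH5-p04 (g2) ((N3), 2026-09-02T07:41Z) and LH10-p02 ((J-H) ED. 2)
between the chart currency of (PROD-QUOT-H) (★ D1∕D2 `endoBlockAt`, `chartTorusHLoc`, `chartOrbHLoc`) and the `torusU` currency of (A0-b) (★ `ArchRankOneSplitOrbitChart` ∕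
`…Continuity`); count-neutral.

THE MATHEMATICS.  At a split place `w ∈ S` the local chart is `endoBlockAt S w cw = hypBlockGL (cw 0) (cw 2) = diag(e^{x+iθ}, e^{−x+iθ})` (§1), so the closure
`T_{S,w} = chartTorusHLoc S w` of its range is the full diagonal torus of `U(Φ₂)_w`: every diagonal unitary element is `diag(a, conj(a)⁻¹)` with `a ≠ 0`, i.e.
`hypBlockGL (log ‖a‖) (arg a)` (§2, `chartTorusHLoc_eq_torusU`).  §3 restates ★ `chartOrbHLoc_eq_of_isHaarMeasure` with the torus as a VARIABLE subgroup `T`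
together with `hT : chartTorusHLoc S w = T` (proof: `subst`), so that consumers instantiate `T := torusU` with THEIR Borel instances on `U(Φ₂)_w ⧸ torusU` and no cast
appears (recipe at the end of §3).

## References
* [Rogawski1990] J. D. Rogawski, *Automorphic Representations of Unitary Groups in Three Variables* (1990), §3.6 p. 31 (the split torus of `U(1,1)`), §8.2 p. 122.
* [Folland1995] G. B. Folland, *A Course in Abstract Harmonic Analysis* (1995), §2.6 Thm. 2.49 (quotient measures).
-/

set_option autoImplicit false

noncomputable section

open MeasureTheory MeasureTheory.Measure NumberField NumberField.InfinitePlace Matrix Complex Topology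
open Literature.MeasureTheory.Group Literature.NumberTheory.Rogawski1990
open scoped MatrixGroups Matrix Classical ENNReal NNReal ComplexConjugate

namespace Literature.NumberTheory.Automorphic.UnitaryGroup

/-! ## §1 The local chart at a split place is `hypBlockGL` -/

section Chart

variable (L : Type) [Field L] [NumberField L] [IsCMField L] (S : Finset {w : InfinitePlace L // IsComplex w}) {w : {w : InfinitePlace L // IsComplex w}}

omit [NumberField L] [IsCMField L] in
/-- **At a split place `w ∈ S`: `endoBlockAt S w cw = diag(e^{cw 0 + i cw 2}, e^{−cw 0 + i cw 2}) = hypBlockGL (cw 0) (cw 2)`** (in `GL₂(ℂ)`).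
[cite: Rogawski1990, §3.6 p. 31] -/
theorem coe_endoBlockAt_of_mem (hw : w ∈ S) (cw : Fin 3 → ℝ) :
    ((endoBlockAt L S w cw : ↥(archLocal L 2 (Matrix.of fun i j : Fin 2 => if i.val + j.val + 1 = 2 then (1 : L) else 0) w)) : GL (Fin 2) ℂ) = hypBlockGL (cw 0) (cw 2) := by
  rw [endoBlockAt_eq_endoBlock]
  unfold endoBlock
  rw [if_pos hw]

omit [NumberField L] [IsCMField L] in
/-- The same as an equality in `U(Φ₂)_w`. [cite: Rogawski1990, §3.6 p. 31] -/
theorem endoBlockAt_eq_mk_hypBlockGL (hw : w ∈ S) (cw : Fin 3 → ℝ) :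
    endoBlockAt L S w cw = ⟨hypBlockGL (cw 0) (cw 2), hypBlockGL_mem_archLocal L w (cw 0) (cw 2)⟩ :=
  Subtype.ext (coe_endoBlockAt_of_mem L S hw cw)

/-! ## §2 `chartTorusHLoc S w = torusU` at a split place -/

/-- **(DOCK-w₀) THE LOCAL CHART TORUS AT A SPLIT PLACE IS THE DIAGONAL TORUS**: `chartTorusHLoc S w = torusU conj (σ_w Φ₂)` for `w ∈ S` — the range of
`cw ↦ diag(e^{x+iθ}, e^{−x+iθ})` is already all of `{diag(a, conj(a)⁻¹) : a ≠ 0}` (`a = e^{log ‖a‖ + i arg a}`), which is the diagonal subgroup of `U(Φ₂)_w`.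
[cite: Rogawski1990, §3.6 p. 31; §1.10 p. 9] -/
theorem chartTorusHLoc_eq_torusU (hw : w ∈ S) :
    chartTorusHLoc L S w = torusU (starRingEnd ℂ) ((Matrix.of fun i j : Fin 2 => if i.val + j.val + 1 = 2 then (1 : L) else 0).map w.1.embedding) := by
  refine Subgroup.ext fun g => (mem_chartTorusHLoc_iff L S w g).trans
    (Iff.trans ?_ (LineRing.mem_torusU_two_iff (starRingEnd ℂ) ((Matrix.of fun i j : Fin 2 => if i.val + j.val + 1 = 2 then (1 : L) else 0).map w.1.embedding) g).symm)
  constructor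
  · rintro ⟨cw, rfl⟩
    rw [coe_endoBlockAt_of_mem L S hw, coe_hypBlockGL]
    simp
  · rintro ⟨h01, h10⟩
    have hmem := (mem_archLocal_iff (E := L) (N := 2) (J := (Matrix.of fun i j : Fin 2 => if i.val + j.val + 1 = 2 then (1 : L) else 0)) (w := w) (g : GL (Fin 2) ℂ)).1 g.2
    rw [Literature.NumberTheory.Rogawski1990.antidiagOne_map] at hmem
    have hmat : ((g : GL (Fin 2) ℂ) : Matrix (Fin 2) (Fin 2) ℂ) =
        !![((g : GL (Fin 2) ℂ) : Matrix (Fin 2) (Fin 2) ℂ) 0 0, 0; 0, ((g : GL (Fin 2) ℂ) : Matrix (Fin 2) (Fin 2) ℂ) 1 1] := by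
      ext i j
      fin_cases i <;> fin_cases j
      · rfl
      · exact h01
      · exact h10
      · rfl
    set a : ℂ := ((g : GL (Fin 2) ℂ) : Matrix (Fin 2) (Fin 2) ℂ) 0 0 with ha_def
    set d : ℂ := ((g : GL (Fin 2) ℂ) : Matrix (Fin 2) (Fin 2) ℂ) 1 1 with hd_def
    rw [hmat] at hmem
    have had : conj a * d = 1 := (diag_mem_unitary_antidiag_iff a d).1 hmem
    have ha : a ≠ 0 := by
      intro h
      rw [h, map_zero, zero_mul] at had
      exact zero_ne_one had
    have hd : d = (conj a)⁻¹ := (inv_eq_of_mul_eq_one_right had).symm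
    have hexp : Complex.exp ((Real.log ‖a‖ : ℂ) + (Complex.arg a : ℂ) * I) = a := by
      rw [Complex.exp_add, ← Complex.ofReal_exp, Real.exp_log (norm_pos_iff.2 ha)]
      exact Complex.norm_mul_exp_arg_mul_I a
    have hexp' : Complex.exp (-(Real.log ‖a‖ : ℂ) + (Complex.arg a : ℂ) * I) = d := by
      rw [hd]
      conv_rhs => rw [← hexp, ← Complex.exp_conj, ← Complex.exp_neg]
      congr 1
      rw [map_add, map_mul, Complex.conj_ofReal, Complex.conj_ofReal, Complex.conj_I]
      ring
    refine ⟨![Real.log ‖a‖, 0, Complex.arg a], Subtype.ext (Units.ext ?_)⟩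
    rw [coe_endoBlockAt_of_mem L S hw, coe_hypBlockGL, hmat]
    simp only [Matrix.cons_val_zero, Matrix.cons_val_two, Matrix.tail_cons, Matrix.head_cons]
    rw [hexp, hexp']

end Chart

/-! ## §3 `chartOrbHLoc` in the frame of ANY torus equal to `T_{S,w}` — in particular `torusU` at a split place -/

section Orb

variable (L : Type) [Field L] (S : Finset {w : InfinitePlace L // IsComplex w}) (w : {w : InfinitePlace L // IsComplex w})
  [MeasurableSpace ↥(archLocal L 2 (Matrix.of fun i j : Fin 2 => if i.val + j.val + 1 = 2 then (1 : L) else 0) w)] [BorelSpace ↥(archLocal L 2 (Matrix.of fun i j : Fin 2 => if i.val + j.val + 1 = 2 then (1 : L) else 0) w)]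
  [LocallyCompactSpace ↥(archLocal L 2 (Matrix.of fun i j : Fin 2 => if i.val + j.val + 1 = 2 then (1 : L) else 0) w)] [SecondCountableTopology ↥(archLocal L 2 (Matrix.of fun i j : Fin 2 => if i.val + j.val + 1 = 2 then (1 : L) else 0) w)]
  (νw : Measure ↥(archLocal L 2 (Matrix.of fun i j : Fin 2 => if i.val + j.val + 1 = 2 then (1 : L) else 0) w)) [νw.IsHaarMeasure] [νw.IsMulRightInvariant]

/-- **`chartOrbHLoc` READ THROUGH ANY SUBGROUP EQUAL TO `T_{S,w}`** (torus as a variable; `subst`): for `T = chartTorusHLoc S w`, closed, with the consumer's Borel structure on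
`U(Φ₂)_w ⧸ T` and any inversion-invariant Haar `t` on `T`,
`chartOrbHLoc ν_w S w f cw = t(B_{S,w}) · ∫_{U(Φ₂)_w ⧸ T} f(x · endoBlockAt S w cw · x⁻¹) d(ν_w ∕ t)` (★ `chartOrbHLoc_eq_of_isHaarMeasure`, the box read inside `T`).
[cite: Folland1995, §2.6 Thm. 2.49] [cite: Rogawski1990, §8.2 p. 122] -/
theorem chartOrbHLoc_eq_of_chartTorusHLoc_eq {T : Subgroup ↥(archLocal L 2 (Matrix.of fun i j : Fin 2 => if i.val + j.val + 1 = 2 then (1 : L) else 0) w)} (hT : chartTorusHLoc L S w = T) (hTc : IsClosed (T : Set ↥(archLocal L 2 (Matrix.of fun i j : Fin 2 => if i.val + j.val + 1 = 2 then (1 : L) else 0) w)))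
    [iT : MeasurableSpace (↥(archLocal L 2 (Matrix.of fun i j : Fin 2 => if i.val + j.val + 1 = 2 then (1 : L) else 0) w) ⧸ T)] [BorelSpace (↥(archLocal L 2 (Matrix.of fun i j : Fin 2 => if i.val + j.val + 1 = 2 then (1 : L) else 0) w) ⧸ T)]
    (t : Measure ↥T) [t.IsHaarMeasure] [t.IsInvInvariant]
    (f : ↥(archLocal L 2 (Matrix.of fun i j : Fin 2 => if i.val + j.val + 1 = 2 then (1 : L) else 0) w) → ℂ) (cw : Fin 3 → ℝ) (hcomm : ∀ m ∈ T, m * endoBlockAt L S w cw = endoBlockAt L S w cw * m) :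
    chartOrbHLoc L S w νw f cw =
      ((t {m : ↥T | (m : ↥(archLocal L 2 (Matrix.of fun i j : Fin 2 => if i.val + j.val + 1 = 2 then (1 : L) else 0) w)) ∈ ((↑) : ↥(chartTorusHLoc L S w) → ↥(archLocal L 2 (Matrix.of fun i j : Fin 2 => if i.val + j.val + 1 = 2 then (1 : L) else 0) w)) '' chartBoxImgLoc L S w}).toReal : ℂ) *
        ∫ x, descConj (endoBlockAt L S w cw) T hcomm f x ∂(quotientMeasure T t hTc νw) := by
  subst hT
  have hi : iT = borel _ := BorelSpace.measurable_eq
  subst hi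
  rw [chartOrbHLoc_eq_of_isHaarMeasure L S w νw t f cw]
  have hset : {m : ↥(chartTorusHLoc L S w) | (m : ↥(archLocal L 2 (Matrix.of fun i j : Fin 2 => if i.val + j.val + 1 = 2 then (1 : L) else 0) w)) ∈ ((↑) : ↥(chartTorusHLoc L S w) → ↥(archLocal L 2 (Matrix.of fun i j : Fin 2 => if i.val + j.val + 1 = 2 then (1 : L) else 0) w)) '' chartBoxImgLoc L S w} =
      chartBoxImgLoc L S w := by
    ext m
    simp only [Set.mem_setOf_eq, Set.mem_image, Subtype.val_inj, exists_eq_right]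
  rw [hset]

/- CONSUMER RECIPE for the `torusU` frame of ★ p850189 (no cast needed): instantiate the previous theorem with
   `T := (torusU (starRingEnd ℂ) (Φ₂.map σ_w) : Subgroup ↥(archLocal L 2 Φ₂ w))` (type-ascribed; `archLocal L 2 Φ₂ w` is by definition
   `unitaryGroupOfForm conj (Φ₂.map σ_w)`), `hT := chartTorusHLoc_eq_torusU L S hw`, `hTc := LineRing.isClosed_torusU_two _ _`,
   `hcomm := LineRing.forall_mem_torusU_comm _ _ (hT ▸ endoBlockAt_mem_chartTorusHLoc L S w cw)`, and rewrite the chart point with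
   `endoBlockAt_eq_mk_hypBlockGL`; instances on `↥(unitaryGroupOfForm …)` demanded by p850189 are the `archLocal` ones (`haveI := ‹…›`). -/

end Orb

end Literature.NumberTheory.Automorphic.UnitaryGroup

end
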